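import Mathlib.Analysis.SpecialFunctions.Sqrt
import Mathlib.Algebra.BigOperators.Fin
import Literature.Computability.Complexity.BoolEncodings
import Literature.Computability.Complexity.Circuit
import Literature.Computability.Complexity.Promise
import Literature.Computability.MetaComplexity.TruthTables
import HarnessLib

/-!
# Forrelation and explicit `k`-fold Forrelation (Aaronson–Ambainis)

Topic `Literature/Computability/QuantumComplexity` (definition item `defn-kForrelationProblem`,
routes `QuantumAdvantage/PromiseLift`, `QuantumAdvantage/AvgCase`, crux #4).

For Boolean functions `f₁, …, f_k : {0,1}ⁿ → {±1}` (we write `fᵢ(x) = (-1)^{[Cᵢ(x)]}` for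
`{0,1}`-valued data) the **`k`-fold forrelation** is the twisted sum

`Φ_{f₁,…,f_k} := 2^{-(k+1)n/2} ∑_{x₁,…,x_k ∈ {0,1}ⁿ} f₁(x₁) (-1)^{x₁·x₂} f₂(x₂) ⋯ (-1)^{x_{k-1}·x_k} f_k(x_k)`

and for `k = 2` the **forrelation** `Φ_{f,g} = 2^{-3n/2} ∑_{x,y} f(x) (-1)^{x·y} g(y)`
(Aaronson–Ambainis 2018, §1.1.1 and §1.1.3). The promise problem is to decide whether
`Φ ≥ 3/5` or `|Φ| ≤ 1/100`. In **explicit** `k`-fold Forrelation the `fᵢ` are given by Boolean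
circuits `C₁, …, C_k`; for `k = poly(n)` this is `PromiseBQP`-complete (ibid., Thm 5 and §6,
Prop. 6, Thm 25).

* `signOf b = (-1)^{[b]} : ℝ`, `twist x y = (-1)^{x·y}` (as the product `∏ₗ (-1)^{xₗ yₗ}`);
* `forrelation f g : ℝ` — black-box `Φ_{f,g}` for `f g : (Fin n → Bool) → Bool` (compose with
  `Literature.Computability.MetaComplexity.ofTruthTable`/`boolFunEquivFin` for truth-table inputs `Fin (2ⁿ) → Bool`);
* `kForrelationValue f : ℝ` — `Φ_{f₀,…,f_{k-1}}` for `f : Fin k → (Fin n → Bool) → Bool`;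
* `KForrelationInstance` — white-box instances `(n, k, C : Fin k → Circuit (Fin n))` (G01
  circuits `Literature.Computability.Complexity.Circuit`), with `IsYes` (`all Cᵢ over B₂ ∧ Φ ≥ 3/5`) and `IsNo`
  (`all Cᵢ over B₂ ∧ |Φ| ≤ 1/100`);
* an explicit, linear-size Boolean **encoding of circuits** — `encodeWire`, `encodeGate`
  (truth table of the gate function, then the list of wires), `encodeCircuit`,
  `KForrelationInstance.encode` — with **injectivity proved** (`encodeCircuit_injective`,
  `KForrelationInstance.encode_injective`); the library so far had no encoding of
  `Circuit (Fin n)` (cf. the remark in `MCSP.lean`);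
* `kForrelationProblem : PromiseProblem` — the yes- and no-languages are the images of `IsYes`/`IsNo` under
  the encoding; `kForrelationProblem_disjoint` (real proof, via injectivity and `1/100 < 3/5`).

## Design choices

* `(-1)^{x·y}` is the product `∏ₗ (if xₗ ∧ yₗ then -1 else 1)`, avoiding parities; the chain of
  twists is indexed by `i : Fin k` with the convention that index `0` carries no twist.
* The number `k` of circuits is part of the instance and unrestricted (membership is meaningful for
  every `k`; hardness statements add `k = poly(n)` themselves), as requested.
* Circuits with a gate outside `B₂` (fan-in `> 2`) are outside the promise (neither yes nor no),
  matching "circuits over `B₂`"; by AA Thm 25 hardness already holds for products of `≤ 3`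
  literals, so the basis is immaterial.
* The encoding is ad hoc but standard (Arora–Barak §0.1-style pairing `boolPair`, binary numbers,
  gate = truth table + wire list, so `|encode C| = O(size · (4 + log))` for `B₂`-circuits); the
  complexity of Forrelation is robust under polynomially related encodings. Only `encode`
  functions are provided (no `Computability.Encoding` structure with a decoder is needed for a
  `Language Bool`); injectivity is what makes the promise problem disjoint.
* Mathlib: `Real.sqrt`, big operators, `Computability.encodeNat`; circuits, `boolPair`,
  `truthTable`, `PromiseProblem` are the library's. Mathlib/H21 had no Forrelation (searched).

## References

* S. Aaronson, A. Ambainis, *Forrelation: a problem that optimally separates quantum from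
  classical computing*, SIAM J. Comput. 47 (2018) 982–1038 (STOC 2015; arXiv:1411.5729):
  §1.1.1 (Forrelation, thresholds `1/100`, `3/5`), §1.1.3 and Thm 5 (`k`-fold), §6 Prop. 6 and
  Thm 25 (explicit `k`-fold Forrelation is `PromiseBQP`-complete for `k = poly(n)`).
* S. Aaronson, *BQP and the polynomial hierarchy*, STOC 2010 ("Fourier checking").
* R. Raz, A. Tal, *Oracle separation of BQP and PH*, J. ACM 69 (2022).
-/

noncomputable section

open Computability Literature.Computability.Complexity Literature.Computability.MetaComplexity Finset

namespace Literature.Computability.QuantumComplexity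

variable {n k : ℕ}

/-! ### The forrelation quantities -/

/-- `(-1)^{[b]}` as a real number: the `{±1}`-valued reading `f(x) = (-1)^{C(x)}` of a Boolean
value. [cite: AaronsonAmbainis2018, §1.1.1] -/
def signOf (b : Bool) : ℝ := if b then -1 else 1

/-- The twist `(-1)^{x·y}` for `x y ∈ {0,1}ⁿ`, written as the product `∏ₗ (-1)^{xₗ yₗ}`.
[cite: AaronsonAmbainis2018, §1.1.1] -/
def twist (x y : Fin n → Bool) : ℝ := ∏ l, if x l && y l then (-1 : ℝ) else 1

/-- **Forrelation** `Φ_{f,g} = 2^{-3n/2} ∑_{x,y ∈ {0,1}ⁿ} f(x) (-1)^{x·y} g(y)` of two Boolean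
functions (values read in `{±1}` via `signOf`): the correlation between `f` and the Boolean Fourier
transform of `g`. Always `|Φ_{f,g}| ≤ 1`. [cite: AaronsonAmbainis2018, §1.1.1] -/
def forrelation (f g : (Fin n → Bool) → Bool) : ℝ :=
  (Real.sqrt (2 ^ (3 * n)))⁻¹ *
    ∑ x : Fin n → Bool, ∑ y : Fin n → Bool, signOf (f x) * twist x y * signOf (g y)

/-- **`k`-fold forrelation**
`Φ_{f₀,…,f_{k-1}} = 2^{-(k+1)n/2} ∑_{x₀,…,x_{k-1}} f₀(x₀) ∏_{0<i<k} (-1)^{x_{i-1}·x_i} f_i(x_i)`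
of `k` Boolean functions on `n` bits (values in `{±1}` via `signOf`).
[cite: AaronsonAmbainis2018, §1.1.3] -/
def kForrelationValue (f : Fin k → (Fin n → Bool) → Bool) : ℝ :=
  (Real.sqrt (2 ^ ((k + 1) * n)))⁻¹ *
    ∑ x : Fin k → (Fin n → Bool),
      ∏ i : Fin k, signOf (f i (x i)) *
        (if h : (i : ℕ) = 0 then 1 else twist (x ⟨(i : ℕ) - 1, by omega⟩) (x i))

/-! ### White-box instances -/

/-- An instance of **explicit `k`-fold Forrelation**: the arity `n`, the number `k` of functions,
and Boolean circuits `C₀, …, C_{k-1}` on `n` inputs computing them (`fᵢ(x) = (-1)^{Cᵢ(x)}`).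
[cite: AaronsonAmbainis2018, §6] -/
structure KForrelationInstance where
  /-- Number of input bits of each function. -/
  n : ℕ
  /-- Number of functions / circuits. -/
  k : ℕ
  /-- The circuits. -/
  C : Fin k → Circuit (Fin n)

namespace KForrelationInstance

/-- The forrelation value `Φ` of the functions computed by the circuits of an instance.
[cite: AaronsonAmbainis2018, §6] -/
def value (I : KForrelationInstance) : ℝ :=
  kForrelationValue fun i => (I.C i).eval

/-- All circuits of the instance are over the full binary basis `B₂` (fan-in `≤ 2`).
[cite: AaronsonAmbainis2018, §6] -/
def IsOverB2 (I : KForrelationInstance) : Prop :=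
  ∀ i, (I.C i).IsOver B2

/-- Yes-instances: `B₂`-circuits with `Φ ≥ 3/5`. [cite: AaronsonAmbainis2018, §1.1.3 and §6] -/
def IsYes (I : KForrelationInstance) : Prop :=
  I.IsOverB2 ∧ 3 / 5 ≤ I.value

/-- No-instances: `B₂`-circuits with `|Φ| ≤ 1/100`. [cite: AaronsonAmbainis2018, §1.1.3 and §6] -/
def IsNo (I : KForrelationInstance) : Prop :=
  I.IsOverB2 ∧ |I.value| ≤ 1 / 100

/-- No instance is both a yes- and a no-instance (`1/100 < 3/5`).
[cite: AaronsonAmbainis2018, §1.1.3] -/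
theorem not_isNo_of_isYes {I : KForrelationInstance} (h : I.IsYes) : ¬ I.IsNo := by
  rintro ⟨-, hno⟩
  have h1 : I.value ≤ 1 / 100 := (le_abs_self _).trans hno
  linarith [h.2]

end KForrelationInstance

/-! ### An explicit Boolean encoding of circuits -/

/-- Fold a list of code words with `boolPair` (`[]` for the empty list): an injective list
encoding when read together with the code words (`encodeCodeList_injective`).
[cite: AroraBarak2009, §0.1] -/
def encodeCodeList (l : List (List Bool)) : List Bool :=
  l.foldr boolPair []

/-- Encoding of a wire of a circuit on `n` inputs: tag bit `false` + binary index for an input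
`inl i`, tag bit `true` + binary index for a gate reference `inr m`. [cite: AroraBarak2009, §6.1] -/
def encodeWire (n : ℕ) : Fin n ⊕ ℕ → List Bool
  | .inl i => false :: encodeNat (i : ℕ)
  | .inr m => true :: encodeNat m

/-- Encoding of a gate: the truth table of its gate function (a bit string of length `2^arity`,
`Literature.Computability.MetaComplexity.truthTable`) paired with the list of its (encoded) argument wires; the arity is the
length of that list. [cite: AroraBarak2009, §6.1] -/
def encodeGate (g : Gate (Fin n)) : List Bool :=
  boolPair (truthTable g.op) (encodeCodeList (List.ofFn fun a => encodeWire n (g.args a)))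

/-- Encoding of a circuit: the list of encoded gates paired with the encoded output wire.
[cite: AroraBarak2009, §6.1] -/
def encodeCircuit (C : Circuit (Fin n)) : List Bool :=
  boolPair (encodeCodeList (C.gates.map encodeGate)) (encodeWire n C.output)

/-- Encoding of an explicit `k`-fold Forrelation instance: `⟨n, ⟨k, [C₀, …, C_{k-1}]⟩⟩` with `n`,
`k` in binary. [cite: AaronsonAmbainis2018, §6] -/
def KForrelationInstance.encode (I : KForrelationInstance) : List Bool :=
  boolPair (encodeNat I.n) (boolPair (encodeNat I.k)
    (encodeCodeList (List.ofFn fun i => encodeCircuit (I.C i))))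

/-! ### Injectivity of the encoding -/

/-- `boolPair` is injective in both arguments jointly. [cite: AroraBarak2009, §0.1] -/
theorem boolPair_inj {x y x' y' : List Bool} : boolPair x y = boolPair x' y' ↔ x = x' ∧ y = y' := by
  constructor
  · intro h
    have := boolPair_injective (a₁ := (x, y)) (a₂ := (x', y')) h
    simpa using this
  · rintro ⟨rfl, rfl⟩
    rfl

/-- The `boolPair`-fold of a list of code words is injective. [cite: AroraBarak2009, §0.1] -/
theorem encodeCodeList_injective : Function.Injective encodeCodeList := by
  intro l
  induction l with
  | nil =>
    intro l' h
    cases l' with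
    | nil => rfl
    | cons a l' =>
      have := congrArg List.length h
      simp [encodeCodeList] at this
      omega
  | cons a l ih =>
    intro l' h
    cases l' with
    | nil =>
      have := congrArg List.length h
      simp [encodeCodeList] at this
    | cons a' l' =>
      obtain ⟨rfl, h2⟩ := boolPair_inj.1 h
      rw [ih h2]

/-- Binary encoding of naturals is injective (Mathlib's `decode_encodeNat`). [folklore] -/
theorem encodeNat_injective : Function.Injective encodeNat := fun a b h => by
  simpa using congrArg decodeNat h

/-- The wire encoding is injective. [cite: AroraBarak2009, §6.1] -/
theorem encodeWire_injective (n : ℕ) : Function.Injective (encodeWire n) := by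
  rintro (i | m) (i' | m') h <;> simp only [encodeWire, List.cons.injEq] at h
  · exact congrArg Sum.inl (Fin.ext (encodeNat_injective h.2))
  · simp at h
  · simp at h
  · exact congrArg Sum.inr (encodeNat_injective h.2)

/-- The gate encoding is injective (the arity is recovered from the number of wires, the gate
function from its truth table). [cite: AroraBarak2009, §6.1] -/
theorem encodeGate_injective : Function.Injective (encodeGate (n := n)) := by
  rintro ⟨a, op, args⟩ ⟨a', op', args'⟩ h
  obtain ⟨h1, h2⟩ := boolPair_inj.1 h
  have h2' := encodeCodeList_injective h2
  have ha : a = a' := by simpa using congrArg List.length h2'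
  subst ha
  obtain rfl : op = op' := truthTable_injective h1
  obtain rfl : args = args' := by
    funext i
    exact encodeWire_injective n (congrFun (List.ofFn_injective h2') i)
  rfl

/-- **The circuit encoding is injective.** [cite: AroraBarak2009, §6.1] -/
theorem encodeCircuit_injective : Function.Injective (encodeCircuit (n := n)) := by
  rintro ⟨gs, out, wf, wfo⟩ ⟨gs', out', wf', wfo'⟩ h
  obtain ⟨h1, h2⟩ := boolPair_inj.1 h
  obtain rfl : gs = gs' :=
    (List.map_injective_iff.2 encodeGate_injective) (encodeCodeList_injective h1)
  obtain rfl : out = out' := encodeWire_injective n h2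
  rfl

/-- **The instance encoding is injective**: distinct instances have distinct codes, so the
yes- and no-languages below faithfully represent the promise problem.
[cite: AaronsonAmbainis2018, §6] -/
theorem KForrelationInstance.encode_injective : Function.Injective KForrelationInstance.encode := by
  rintro ⟨n, k, C⟩ ⟨n', k', C'⟩ h
  obtain ⟨h1, h2⟩ := boolPair_inj.1 h
  obtain rfl : n = n' := encodeNat_injective h1
  obtain ⟨h3, h4⟩ := boolPair_inj.1 h2
  obtain rfl : k = k' := encodeNat_injective h3
  obtain rfl : C = C' := by
    funext i
    exact encodeCircuit_injective (congrFun (List.ofFn_injective (encodeCodeList_injective h4)) i)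
  rfl

/-! ### The promise problem -/

/-- **Explicit `k`-fold Forrelation** as a promise problem over `{0,1}` (white box: the functions
are given by `B₂`-circuits, `k` is part of the input): yes-instances are the codes of instances
with `Φ ≥ 3/5`, no-instances the codes of instances with `|Φ| ≤ 1/100`. For `k = poly(n)` it is
`PromiseBQP`-complete (Aaronson–Ambainis 2018, Thm 5; §6, Prop. 6 and Thm 25).
[cite: AaronsonAmbainis2018, §1.1.3 and §6] -/
def kForrelationProblem : PromiseProblem :=
  ⟨KForrelationInstance.encode '' {I | I.IsYes}, KForrelationInstance.encode '' {I | I.IsNo}⟩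

/-- The code of an instance is a yes-instance iff the instance is (injectivity of the encoding).
[cite: AaronsonAmbainis2018, §6] -/
@[simp] theorem encode_mem_kForrelationProblem_yes_iff (I : KForrelationInstance) :
    I.encode ∈ kForrelationProblem.yes ↔ I.IsYes :=
  KForrelationInstance.encode_injective.mem_set_image

/-- The code of an instance is a no-instance iff the instance is (injectivity of the encoding).
[cite: AaronsonAmbainis2018, §6] -/
@[simp] theorem encode_mem_kForrelationProblem_no_iff (I : KForrelationInstance) :
    I.encode ∈ kForrelationProblem.no ↔ I.IsNo :=
  KForrelationInstance.encode_injective.mem_set_image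

/-- **Explicit `k`-fold Forrelation is a genuine (disjoint) promise problem.**
[cite: AaronsonAmbainis2018, §1.1.3] -/
theorem kForrelationProblem_disjoint : kForrelationProblem.Disjoint := by
  refine Set.disjoint_left.2 ?_
  rintro w ⟨I, hI, rfl⟩ hno
  exact I.not_isNo_of_isYes hI ((encode_mem_kForrelationProblem_no_iff I).1 hno)

/-! ### Small sanity lemmas -/

/-- `signOf` takes values `±1`. [cite: AaronsonAmbainis2018, §1.1.1] -/
theorem abs_signOf (b : Bool) : |signOf b| = 1 := by
  cases b <;> simp [signOf]

/-- The twist is `±1`. [cite: AaronsonAmbainis2018, §1.1.1] -/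
theorem abs_twist (x y : Fin n → Bool) : |twist x y| = 1 := by
  rw [twist, Finset.abs_prod]
  exact Finset.prod_eq_one fun l _ => by split_ifs <;> simp

/-- The twist is symmetric: `x·y = y·x`. [cite: AaronsonAmbainis2018, §1.1.1] -/
theorem twist_comm (x y : Fin n → Bool) : twist x y = twist y x := by
  simp only [twist, Bool.and_comm]

end Literature.Computability.QuantumComplexity

end
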